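import Summits.ResolutionOfSingularities.ResolutionOfSingularities.Theorems.MaxContactCutLassoCut

/-!
# MaxContactCutLassoCutAsides — the route asides of node «LassoCut» unfolded and keyed BY NAME
(decomp-res writer g4; companion of `MaxContactCutLassoCut`, filed once the asides `MaxContactCut.LCNoLassos`,
`MaxContactCut.LCNoAperiodicWalks`, `MaxContactCut.LCNoDefectLassosDeep`,
`MaxContactCut.LCNoAperiodicDefectWalksDeep` exist on the route).  Every statement here is an `Iff.rfl` unfolding or a by-name
re-keying of a kernel of `MaxContactCutLassoCut`; 0 sorry. [folklore]
-/

namespace Summit.ResolutionOfSingularities.ResolutionOfSingularities.Theorems.MaxContactCutLassoCutAsides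

open MvPolynomial
open Literature.AlgebraicGeometry.Resolution
open Literature.AlgebraicGeometry.Resolution.PointBlowup
open Summit.ResolutionOfSingularities.ResolutionOfSingularities.Theses
open Summit.ResolutionOfSingularities.ResolutionOfSingularities.Theorems
open TightDefectClasses WeakOrderReduction ForcedTowerClasses LassoCut
open MaxContactCutLassoCut

/-! ## The asides unfolded -/

/-- `LCNoLassos` is the node's Σ₁ half. [folklore] -/
theorem lcNoLassos_iff : MaxContactCut.LCNoLassos ↔ NoLassos := Iff.rfl

/-- `LCNoAperiodicWalks` is the node's Π half. [folklore] -/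
theorem lcNoAperiodicWalks_iff : MaxContactCut.LCNoAperiodicWalks ↔ NoAperiodicWalks := Iff.rfl

/-- `LCNoDefectLassosDeep` is the node's Σ₁ half of 31770. [folklore] -/
theorem lcNoDefectLassosDeep_iff : MaxContactCut.LCNoDefectLassosDeep ↔ NoDefectLassosDeep := Iff.rfl

/-- `LCNoAperiodicDefectWalksDeep` is the node's Π half of 31770. [folklore] -/
theorem lcNoAperiodicDefectWalksDeep_iff : MaxContactCut.LCNoAperiodicDefectWalksDeep ↔ NoAperiodicDefectWalksDeep := Iff.rfl

/-! ## The same edges at aside level -/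

/-- **EXACT at aside level: 31770 ⟺ `LCNoDefectLassosDeep ∧ LCNoAperiodicDefectWalksDeep`** (no port). [folklore] -/
theorem defectWalksDeep_iff_asides :
    MaxContactCut.DefectWalksDeep ↔ MaxContactCut.LCNoDefectLassosDeep ∧ MaxContactCut.LCNoAperiodicDefectWalksDeep :=
  defectWalksDeep_iff_lasso

/-- 31770 from the two asides. [folklore] -/
theorem defectWalksDeep_of_asides (hL : MaxContactCut.LCNoDefectLassosDeep)
    (hA : MaxContactCut.LCNoAperiodicDefectWalksDeep) : MaxContactCut.DefectWalksDeep :=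
  defectWalksDeep_iff_asides.mpr ⟨hL, hA⟩

/-- **30253 ⟹ both model asides** modulo the realisation port. [folklore] -/
theorem asides_of_noForcedTowers (hR : TowerRealisation) (h : MaxContactCut.NoForcedTowers) :
    MaxContactCut.LCNoLassos ∧ MaxContactCut.LCNoAperiodicWalks :=
  halves_of_noForcedTowers hR h

/-- The two model asides give the model crux `WalksTerminate` (EXACT, `walksTerminate_iff_lasso`). [folklore] -/
theorem walksTerminate_iff_asides : WalksTerminate ↔ MaxContactCut.LCNoLassos ∧ MaxContactCut.LCNoAperiodicWalks :=
  walksTerminate_iff_lasso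

/-- … hence 31770 (port-free, through `MaxContactCutTightDefect.defectWalksDeep_of_walksTerminate`'s pattern:
`WalksTerminate ⟹ DefectWalksTerminateDeep`). [folklore] -/
theorem defectWalksDeep_of_modelAsides (hL : MaxContactCut.LCNoLassos) (hA : MaxContactCut.LCNoAperiodicWalks) :
    MaxContactCut.DefectWalksDeep :=
  MaxContactCutTightDefect.defectWalksDeep_iff.mpr
    (defectDeep_of_halves (fun p hp e he K _ _ _ _ s₀ hs L _ => hL p hp e (by omega) K s₀ hs L)
      (fun p hp e he K _ _ _ _ s₀ hs W _ hW => hA p hp e (by omega) K s₀ hs W hW))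

/-- **31769 `PolyPureTowersDeep` and the whole pure-head slice from the two model asides** modulo the dictionary
port. [folklore] -/
theorem polyPureTowersDeep_of_asides (hD : TowerDictionary) (hL : MaxContactCut.LCNoLassos)
    (hA : MaxContactCut.LCNoAperiodicWalks) : MaxContactCut.PolyPureTowersDeep :=
  (polyPureTowersTerminate_iff_columns.mp (polyPureTowersTerminate_of_halves hD hL hA)).2

end Summit.ResolutionOfSingularities.ResolutionOfSingularities.Theorems.MaxContactCutLassoCutAsides
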